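/-
Copyright (c) 2026 the pub-hodgecm-mathlib formalisation cell (harness21).  Prover seat hodgecm-mathlib-F0P2-p10 (g4), Track B ∕ R90-TF, h413 = `stmt-HodgeConjecture-24833`,
R90-TF section S8 «ContSpec-n½», socket (E) :276, E1-PLANCHEREL BODY, letter `hFub` piece (c2)+(c3) (S8 dealer R90-CS-plan (g4) S8-R285; joint census `R90/S8/CENSUS-PlancherelBody-bricks.K2E1-p16-F0P2-p10.md` §PB-1):
THE `w`-SLICE OF THE INTERTWINED BRACKET — `∫ β•((f∘H)φ·conj(∫_N f′^{φ′}_w(w₀vg)dν)) dν_G` is a `[Ψ₁]`-type bracket whose second section is the intertwined coefficient `𝓜̃_w = M(w₀,w)φ′` (a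
section of the REFLECTED pair) and whose second profile is `r^{2−w}`: it VANISHES when the reflected pair misses `(χ₁,χ₂)` (★ C4a) and equals `K·V·mellin f(−w̄)·⟪φ,𝓜̃_w⟫_{K_U}` when it hits it
(★ PB-1b-i + Tate).
-/
import Summits.HodgeConjecture.HodgeConjecture.Theorems.K2E1ChiPseudoEisensteinBracketOneMellinCMThree   -- ★ PB-1b-ii p865252: Tate `setIntegral_mul_inv_ideleNorm_smul_comp_eq`; brings ★ PB-1b-i p865195, ★ C4a, ★ A
import Summits.HodgeConjecture.HodgeConjecture.Theorems.K2E1ChiIntertwinedCoeffKMaxCMThree              -- ★ (K2E1-p11): `continuous_intertwinedCoeff`, `exists_norm_intertwinedCoeff_le`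
import Summits.HodgeConjecture.HodgeConjecture.Theorems.K2E1ChiIntertwinedSectionU3                     -- ★ `isChiSectionPair_intertwinedCoeff_three`, `flatSectionU_intertwinedCoeff_three_eq`
import Summits.HodgeConjecture.HodgeConjecture.Theorems.K2E1ChiPseudoEisensteinIdeleSplitCMTwo           -- ★ `norm_reflectChar_apply_of_isUnitary`
import HarnessLib

/-!
# hFub-c2∕c3 — `K2E1ChiIntertwinedSliceBracketCMThree`: THE `w`-SLICE OF THE INTERTWINED BRACKET `[Ψ₂]_β` ON `U(2,1)` — VANISHING (MISSES) ∕ MELLIN EVALUATION (HITS)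

Track B ∕ R90-TF, crux h413 = `stmt-HodgeConjecture-24833`, route of record `HCCMUnconditional`; cell `hodgecm-mathlib`, R90-TF programme, section S8 «ContSpec-n½», socket (E)
(B ED. 7 :276), E1-PLANCHEREL BODY.  After ★ PB-1a p865168, ★ PB-1b p865195 + p865252, ★ hFub-a p865351 and ★ hFub-b p865376, the intertwined bracket is
`[Ψ₂]_β = ∫ β•((f∘H)φ·conj((ν𝓕)⁻¹•(2π)⁻¹∫_ℝ mellin f′(−w)·𝓘_w dy)) dν_G` with `𝓘_w(g) := ∫_{N(𝔸)} f′^{φ′}_w(w₀vg) dν(v)` (`w = c₀+iy`, `c₀ > 2`).  THIS FILE evaluates the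
`w`-SLICE `S_w := ∫ β•((f∘H)φ·conj 𝓘_w) dν_G` for each fixed `w` with `Re w > 2`; the remaining piece (c1) is the Fubini swap `G(𝔸) × {Re w = c₀}` that puts the slices back
under the `y`-integral.  THEOREMS ONLY (no `def`, no `instance`, no notation, no named-fact hypothesis, no `sorry`; default heartbeats);
lane `--supports stmt-HodgeConjecture-24833 --as helper` (count-neutral).

THE MATHEMATICS ([MoeglinWaldspurger1995] II.1.6–II.1.7, II.2.1; [Rogawski1990] §7.3; [TateThesis1967] §4.3–4.4).  KEY REMARK: by ★ `flatSectionU_intertwinedCoeff_three_eq`,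
`𝓘_w(g) = 𝓜̃_w(g)·H(g)^{2−w}` with the INTERTWINED COEFFICIENT `𝓜̃_w(g) := (∫_N f′^{φ′}_w(w₀(vg))dν)·H(g)^{w−2}`, which is a `(χ₁′ʷ, χ₂′)`-PAIR SECTION (`χ₁′ʷ = reflectChar c χ₁′`,
★ `isChiSectionPair_intertwinedCoeff_three`), continuous (★ `continuous_intertwinedCoeff`, `Re w > 2`, `χ₂′` automorphic) and bounded (★ `exists_norm_intertwinedCoeff_le`).  Choosing a
bump `b ∈ C_c((0,∞))` with `b ≡ 1` on `tsupport f` (Urysohn, §1) and the profile `f′_w(r) := r^{2−w}·b(r) ∈ C_c((0,∞))`, the slice integrand equals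
`β•((f∘H)φ·conj((f′_w∘H)·𝓜̃_w))` POINTWISE (where `f(Hg) ≠ 0`, `b(Hg) = 1`; elsewhere both vanish) — a `[Ψ₁]`-TYPE BRACKET with second pair `(χ₁′ʷ, χ₂′)`.  Hence:
* §3 `MISSES` (`χ₂ ≠ χ₂′` or `χ₁·(χ₁′ʷ)⁻¹` not a norm twist): **`S_w ∈ L¹` and `S_w = 0`** — ★ C4a `integral_weight_smul_wOne_eq_zero_cm_three` by name;
* §4 `HITS` (`χ₁′ʷ = χ₁`, `χ₂′ = χ₂`): ★ PB-1b-i p865195 gives `S_w = K·∫_{𝓕_I}(‖x‖‖x‖)⁻¹•(f(‖x‖)·conj f′_w(‖x‖)·⟪φ,𝓜̃_w⟫_{K_U}) dν_I`, `conj f′_w(‖x‖) = ‖x‖^{2−w̄}` on the support of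
  `f(‖x‖)`, Tate's `d^×x` (★ PB-1b-ii §2) and `∫_0^∞ r^{2−w̄} f(r) r^{−3} dr = mellin f(−w̄)` give **`S_w = K·V·mellin f(−w̄)·⟪φ,𝓜̃_w⟫_{K_U}`** (`V = idelicCovolume`), uniformly:
  ONE `(K, V)` for all data.
The norm-twist-shifted self-associate case (`χ₁(χ₁′ʷ)⁻¹ = ‖·‖^{it}`, `t ≠ 0`) is not treated here (c2′; `N = 2` precedent ★ `K2E1ChiPseudoEisensteinSelfDualCMTwo`).

HONEST LABEL.  Pieces (c2)+(c3) of one named letter; (c1) (the second Fubini) remains; pays nothing at the (E) socket.  HC_CM is proved only modulo the 7 printed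
citations (2 remaining named inputs: hLiu418 = `stmt-HodgeConjecture-24832`, h413 = `stmt-HodgeConjecture-24833`) until rung 0 closes; count-neutral.
-/

set_option autoImplicit false
set_option linter.dupNamespace false  -- the mandated namespace repeats the summit's segment (`HodgeConjecture.HodgeConjecture`)

noncomputable section

open MeasureTheory Measure Set Filter Topology Complex NumberField IsDedekindDomain MulAction Function
open scoped Real NNReal ENNReal ComplexConjugate
open Literature.MeasureTheory.Group Literature.NumberTheory
open Literature.NumberTheory.Automorphic Literature.NumberTheory.Automorphic.UnitaryGroup AdelicGroupData
open Literature.NumberTheory.GaloisRepresentations (HeckeCharacter ideleGroup)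
open Literature.NumberTheory.Automorphic.Arthur2013.Leaves.TECR
open Summit.HodgeConjecture.HodgeConjecture.Cruxes.H413.K2E1BorelEisensteinU
open Summit.HodgeConjecture.HodgeConjecture.Cruxes.H413.K2E1CharacterEisensteinU2Defs
open Summit.HodgeConjecture.HodgeConjecture.Cruxes.H413.K2E1CharacterEisensteinU3PairDefs
open Summit.HodgeConjecture.HodgeConjecture.Cruxes.H413.K2E1MellinPaleyWienerHalfLine (continuous_ofReal_cpow_mul)
open Summit.HodgeConjecture.HodgeConjecture.Cruxes.H413.K2E1ChiIntertwinedSectionU3 (isChiSectionPair_intertwinedCoeff_three flatSectionU_intertwinedCoeff_three_eq)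
open Summit.HodgeConjecture.HodgeConjecture.Cruxes.H413.K2E1ChiIntertwinedCoeffKMaxCMThree (continuous_intertwinedCoeff exists_norm_intertwinedCoeff_le)
open Summit.HodgeConjecture.HodgeConjecture.Cruxes.H413.K2E1ChiPseudoEisensteinIdeleSplitCMTwo (norm_reflectChar_apply_of_isUnitary)
open Summit.HodgeConjecture.HodgeConjecture.Cruxes.H413.K2E1ChiPseudoEisensteinWeightBracketsCMThree (integral_weight_smul_wOne_eq_zero_cm_three)
open Summit.HodgeConjecture.HodgeConjecture.Cruxes.H413.K2E1ChiPseudoEisensteinBracketOneIdeleCMThree (integral_weight_smul_wOne_eq_setIntegral_ideleClass_cm_three)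
open Summit.HodgeConjecture.HodgeConjecture.Cruxes.H413.K2E1ChiPseudoEisensteinBracketOneMellinCMThree (setIntegral_mul_inv_ideleNorm_smul_comp_eq)

namespace Summit.HodgeConjecture.HodgeConjecture.Cruxes.H413.K2E1ChiIntertwinedSliceBracketCMThree

/-! ## §1 A bump `b ∈ C_c((0,∞))` with `b ≡ 1` on `tsupport f`, and the slice profile `f′_w = r^{2−w}·b` -/

section Bump

/-- **Urysohn bump on the support**: for `f` of compact support inside `(0,∞)` there is a continuous `b : ℝ → ℝ` of compact support inside `(0,∞)` with `b = 1` on `tsupport f`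
(Mathlib `exists_open_between_and_isCompact_closure` + `exists_tsupport_one_of_isOpen_isClosed`). [folklore] -/
theorem exists_bump_eq_one_on_tsupport {f : ℝ → ℂ} (hfs : HasCompactSupport f) (hf0 : tsupport f ⊆ Ioi 0) :
    ∃ b : ℝ → ℝ, Continuous b ∧ HasCompactSupport b ∧ tsupport b ⊆ Ioi 0 ∧ ∀ r ∈ tsupport f, b r = 1 := by
  obtain ⟨V, hVo, hKV, hVU, hVc⟩ := exists_open_between_and_isCompact_closure hfs.isCompact isOpen_Ioi hf0
  obtain ⟨g, hgV, hg1, -⟩ := exists_tsupport_one_of_isOpen_isClosed hVo hVc (isClosed_tsupport f) hKV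
  exact ⟨g, g.continuous, hVc.of_isClosed_subset (isClosed_tsupport _) (hgV.trans subset_closure), hgV.trans (subset_closure.trans hVU),
    fun r hr => by simpa using hg1 hr⟩

/-- The complexified bump has support inside that of `b`. [folklore] -/
theorem tsupport_ofReal_comp_subset (b : ℝ → ℝ) : tsupport (fun r : ℝ => ((b r : ℝ) : ℂ)) ⊆ tsupport b :=
  closure_mono fun r hr h => hr (by simp only [h, Complex.ofReal_zero])

/-- **The slice profile `f′_w(r) = r^{2−w}·b(r)` is continuous with compact support** (`b ∈ C_c((0,∞))`; ★ A `continuous_ofReal_cpow_mul`). [folklore] -/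
theorem continuous_sliceProfile {b : ℝ → ℝ} (hbc : Continuous b) (hb0 : tsupport b ⊆ Ioi 0) (w : ℂ) :
    Continuous fun r : ℝ => (r : ℂ) ^ (2 - w) * ((b r : ℝ) : ℂ) :=
  continuous_ofReal_cpow_mul (Complex.continuous_ofReal.comp hbc) ((tsupport_ofReal_comp_subset b).trans hb0) (2 - w)

/-- Compact support of the slice profile. [folklore] -/
theorem hasCompactSupport_sliceProfile {b : ℝ → ℝ} (hbs : HasCompactSupport b) (w : ℂ) :
    HasCompactSupport fun r : ℝ => (r : ℂ) ^ (2 - w) * ((b r : ℝ) : ℂ) :=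
  (hbs.comp_left (g := Complex.ofReal) Complex.ofReal_zero).mul_left

/-- For `r > 0`: `conj (r^{2−w}) = r^{2−w̄}` (real positive base). [folklore] -/
theorem conj_ofReal_cpow_two_sub {r : ℝ} (hr : 0 < r) (w : ℂ) : conj ((r : ℂ) ^ (2 - w)) = (r : ℂ) ^ (2 - conj w) := by
  have harg : (r : ℂ).arg ≠ π := by rw [Complex.arg_ofReal_of_nonneg hr.le]; exact Real.pi_pos.ne
  rw [show (2 : ℂ) - conj w = conj (2 - w) by rw [map_sub, map_ofNat], Complex.cpow_conj _ _ harg, Complex.conj_ofReal]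

/-- For `r > 0`: `r^{2−w̄}·r^{−3} = r^{−w̄−1}` (the Mellin exponent at `s = −w̄`). [folklore] -/
theorem cpow_two_sub_mul_cpow_neg_three {r : ℝ} (hr : 0 < r) (w : ℂ) : (r : ℂ) ^ (2 - conj w) * (r : ℂ) ^ (-3 : ℂ) = (r : ℂ) ^ (-conj w - 1) := by
  rw [← Complex.cpow_add _ _ (Complex.ofReal_ne_zero.2 hr.ne')]
  congr 1
  ring

/-- **`∫_0^∞ r^{2−w̄}·f(r)·c·r^{−3} dr = mellin f(−w̄)·c`** (Mathlib `mellin`: `mellin f s = ∫_0^∞ t^{s−1}•f t`). [cite: Titchmarsh1948, §1.29] -/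
theorem setIntegral_sliceRadial_mul_cpow_neg_three (f : ℝ → ℂ) (w c : ℂ) :
    ∫ r in Ioi (0 : ℝ), (r : ℂ) ^ (2 - conj w) * f r * c * (r : ℂ) ^ (-3 : ℂ) = mellin f (-conj w) * c := by
  rw [mellin, ← integral_mul_const]
  refine setIntegral_congr_fun measurableSet_Ioi fun r hr => ?_
  rw [smul_eq_mul, ← cpow_two_sub_mul_cpow_neg_three hr]
  ring

end Bump

/-! ## §2 The slice integrand is a `[Ψ₁]`-type integrand with second section `𝓜̃_w` and second profile `f′_w` -/

section Slice

variable (L : Type) [Field L] [NumberField L] [IsCMField L]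
variable [MeasurableSpace (quasiSplit (↥(maximalRealSubfield L)) L (IsCMField.complexConj L) 3).Adelic] [BorelSpace (quasiSplit (↥(maximalRealSubfield L)) L (IsCMField.complexConj L) 3).Adelic]

omit [BorelSpace (quasiSplit (↥(maximalRealSubfield L)) L (IsCMField.complexConj L) 3).Adelic] in
/-- **POINTWISE IDENTIFICATION**: with `𝓘_w(g) = ∫_N f′^{φ′}_w(w₀vg) dν`, `𝓜̃_w(g) = (∫_N f′^{φ′}_w(w₀(vg)) dν)·H(g)^{w−2}` and a bump `b ≡ 1` on `tsupport f`:
`f(Hg)·φ(g)·conj 𝓘_w(g) = f(Hg)·φ(g)·conj((H(g)^{2−w}·b(Hg))·𝓜̃_w(g))` for every `g` (★ `flatSectionU_intertwinedCoeff_three_eq`; both sides vanish off the support of `f∘H`).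
[cite: MoeglinWaldspurger1995, II.1.7] -/
theorem slice_integrand_eq (ν : Measure ↥(adelicUnipotent (↥(maximalRealSubfield L)) L (IsCMField.complexConj L) 3)) {φ φ' : (quasiSplit (↥(maximalRealSubfield L)) L (IsCMField.complexConj L) 3).Adelic → ℂ} {f : ℝ → ℂ} {b : ℝ → ℝ} (hb1 : ∀ r ∈ tsupport f, b r = 1) (w : ℂ) (g : (quasiSplit (↥(maximalRealSubfield L)) L (IsCMField.complexConj L) 3).Adelic) :
    f (borelHeight g : ℝ) * φ g * conj (∫ v : ↥(adelicUnipotent (↥(maximalRealSubfield L)) L (IsCMField.complexConj L) 3), flatSectionU φ' w ((quasiSplit (↥(maximalRealSubfield L)) L (IsCMField.complexConj L) 3).toAdelic (weylLongU ((IsCMField.complexConj L : L ≃ₐ[↥(maximalRealSubfield L)] L) : L →+* L) (rfl : (StdForm.antidiagonal 3).over L = (StdForm.antidiagonal 3).over L)) * (v : (quasiSplit (↥(maximalRealSubfield L)) L (IsCMField.complexConj L) 3).Adelic) * g) ∂ν) =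
      f (borelHeight g : ℝ) * φ g * conj (((((borelHeight g : ℝ) : ℂ) ^ (2 - w) * ((b (borelHeight g : ℝ) : ℝ) : ℂ)) * ((∫ v : ↥(adelicUnipotent (↥(maximalRealSubfield L)) L (IsCMField.complexConj L) 3), flatSectionU φ' w ((quasiSplit (↥(maximalRealSubfield L)) L (IsCMField.complexConj L) 3).toAdelic (weylLongU ((IsCMField.complexConj L : L ≃ₐ[↥(maximalRealSubfield L)] L) : L →+* L) (rfl : (StdForm.antidiagonal 3).over L = (StdForm.antidiagonal 3).over L)) * ((v : (quasiSplit (↥(maximalRealSubfield L)) L (IsCMField.complexConj L) 3).Adelic) * g)) ∂ν) * (((borelHeight g : ℝ) : ℂ) ^ (w - 2))))) := by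
  by_cases hfg : f (borelHeight g : ℝ) = 0
  · simp only [hfg, zero_mul]
  · have hb : b (borelHeight g : ℝ) = 1 := hb1 _ (subset_tsupport f hfg)
    rw [flatSectionU_intertwinedCoeff_three_eq ν φ' w g, flatSectionU_apply, hb]
    congr 2
    push_cast
    ring

end Slice

/-! ## §3 HEAD `MISSES`: the slice vanishes when the reflected pair misses `(χ₁, χ₂)` -/

section Heads

variable (L : Type) [Field L] [NumberField L] [IsCMField L]
variable [MeasurableSpace (quasiSplit (↥(maximalRealSubfield L)) L (IsCMField.complexConj L) 3).Adelic] [BorelSpace (quasiSplit (↥(maximalRealSubfield L)) L (IsCMField.complexConj L) 3).Adelic]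
variable [MeasurableSpace (AdeleRing (𝓞 L) L)ˣ] [BorelSpace (AdeleRing (𝓞 L) L)ˣ]

/-- **hFub-c2 `MISSES` — THE `w`-SLICE OF THE INTERTWINED BRACKET VANISHES OFF THE SELF-ASSOCIATE LOCUS.**  Structural data: Haar `ν_G`, `μ_K`, `ν_I`, an idele class domain `𝓕_I`;
a Haar measure `ν` on `N(𝔸_{L⁺})` with a fundamental domain `𝓕` of `N(L⁺)` of compact closure; a covering weight `β`; pair sections `φ ∈ (χ₁,χ₂)`, `φ′ ∈ (χ₁′,χ₂′)` continuous bounded,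
`χ₁′` unitary, `χ₂, χ₂′` automorphic; `f ∈ C_c((0,∞))`; `Re w > 2`.  If `χ₂ ≠ χ₂′` or `χ₁·(χ₁′ʷ)⁻¹` is NOT a norm twist (`χ₁′ʷ = reflectChar c χ₁′`), then the slice integrand
`β•((f∘H)φ·conj(∫_N f′^{φ′}_w(w₀vg) dν))` is in `L¹(ν_G)` and **`S_w = ∫ β•((f∘H)φ·conj 𝓘_w) dν_G = 0`** — §2 + ★ C4a `integral_weight_smul_wOne_eq_zero_cm_three` with the second pair
`(χ₁′ʷ, χ₂′)`, second section `𝓜̃_w` (★ `isChiSectionPair_intertwinedCoeff_three`, ★ `continuous_intertwinedCoeff`, ★ `exists_norm_intertwinedCoeff_le`) and second profile `f′_w`.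
[cite: MoeglinWaldspurger1995, II.1.7, II.2.1] [cite: TateThesis1967, Thm. 4.4.1 (Lemma B)] [cite: Rogawski1990, §7.3 (pp. 96–98)] -/
theorem integral_weight_smul_intertwinedSlice_eq_zero_cm_three
    (νG : Measure (quasiSplit (↥(maximalRealSubfield L)) L (IsCMField.complexConj L) 3).Adelic) [νG.IsHaarMeasure] (μK : Measure ((standardMaximalCompactGL 3 L).comap (adelicVal (↥(maximalRealSubfield L)) L (IsCMField.complexConj L) 3 ((StdForm.antidiagonal 3).over L)) : Subgroup (quasiSplit (↥(maximalRealSubfield L)) L (IsCMField.complexConj L) 3).Adelic)) [μK.IsHaarMeasure] (νI : Measure (AdeleRing (𝓞 L) L)ˣ) [νI.IsHaarMeasure]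
    {𝓕I : Set (AdeleRing (𝓞 L) L)ˣ} (h𝓕I : IsIdeleClassDomain L 𝓕I)
    (ν : Measure ↥(adelicUnipotent (↥(maximalRealSubfield L)) L (IsCMField.complexConj L) 3)) [ν.IsHaarMeasure] {𝓕 : Set ↥(adelicUnipotent (↥(maximalRealSubfield L)) L (IsCMField.complexConj L) 3)}
    (h𝓕N : IsFundamentalDomain ↥(rationalUnipotent (↥(maximalRealSubfield L)) L (IsCMField.complexConj L) 3) 𝓕 ν) (h𝓕c : IsCompact (closure 𝓕))
    {β : (quasiSplit (↥(maximalRealSubfield L)) L (IsCMField.complexConj L) 3).Adelic → ℝ≥0∞} (hβ : IsCoveringWeight ((arithmeticBorel (↥(maximalRealSubfield L)) L (IsCMField.complexConj L) 3).map (quasiSplit (↥(maximalRealSubfield L)) L (IsCMField.complexConj L) 3).arithmeticSubgroup.subtype) β)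
    {χ₁ χ₁' : HeckeCharacter L} {χ₂ χ₂' : ↥(TorusDict.torus (IsCMField.complexConj L)) →ₜ* ℂˣ} {φ φ' : (quasiSplit (↥(maximalRealSubfield L)) L (IsCMField.complexConj L) 3).Adelic → ℂ}
    (hχ₁'u : χ₁'.IsUnitary) (hχ₂ : TorusDict.IsAutomorphic (IsCMField.complexConj L) χ₂) (hχ₂' : TorusDict.IsAutomorphic (IsCMField.complexConj L) χ₂')
    (hna : χ₂ ≠ χ₂' ∨ ¬ (χ₁ * (reflectChar (IsCMField.complexConj L) χ₁')⁻¹).IsNormTwist)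
    (hφ : IsChiSectionPair χ₁ χ₂ φ) (hφc : Continuous φ) {Cφ : ℝ} (hφC : ∀ x, ‖φ x‖ ≤ Cφ)
    (hφ' : IsChiSectionPair χ₁' χ₂' φ') (hφ'c : Continuous φ') {Cφ' : ℝ} (hφ'C : ∀ x, ‖φ' x‖ ≤ Cφ')
    {f : ℝ → ℂ} (hf : Continuous f) (hfs : HasCompactSupport f) (hf0 : tsupport f ⊆ Ioi 0) {w : ℂ} (hw : 2 < w.re) :
    Integrable (fun g : (quasiSplit (↥(maximalRealSubfield L)) L (IsCMField.complexConj L) 3).Adelic => (β g).toReal • (f (borelHeight g : ℝ) * φ g * conj (∫ v : ↥(adelicUnipotent (↥(maximalRealSubfield L)) L (IsCMField.complexConj L) 3), flatSectionU φ' w ((quasiSplit (↥(maximalRealSubfield L)) L (IsCMField.complexConj L) 3).toAdelic (weylLongU ((IsCMField.complexConj L : L ≃ₐ[↥(maximalRealSubfield L)] L) : L →+* L) (rfl : (StdForm.antidiagonal 3).over L = (StdForm.antidiagonal 3).over L)) * (v : (quasiSplit (↥(maximalRealSubfield L)) L (IsCMField.complexConj L) 3).Adelic) * g) ∂ν)))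 νG ∧
      ∫ g : (quasiSplit (↥(maximalRealSubfield L)) L (IsCMField.complexConj L) 3).Adelic, (β g).toReal • (f (borelHeight g : ℝ) * φ g * conj (∫ v : ↥(adelicUnipotent (↥(maximalRealSubfield L)) L (IsCMField.complexConj L) 3), flatSectionU φ' w ((quasiSplit (↥(maximalRealSubfield L)) L (IsCMField.complexConj L) 3).toAdelic (weylLongU ((IsCMField.complexConj L : L ≃ₐ[↥(maximalRealSubfield L)] L) : L →+* L) (rfl : (StdForm.antidiagonal 3).over L = (StdForm.antidiagonal 3).over L)) * (v : (quasiSplit (↥(maximalRealSubfield L)) L (IsCMField.complexConj L) 3).Adelic) * g) ∂ν)) ∂νG = 0 := by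
  have hc : IsCMField.complexConj L * IsCMField.complexConj L = 1 := AlgEquiv.ext fun x => IsCMField.complexConj_apply_apply L x
  have hc1 : IsCMField.complexConj L ≠ 1 := IsCMField.complexConj_ne_one L
  obtain ⟨b, hbc, hbs, hb0, hb1⟩ := exists_bump_eq_one_on_tsupport hfs hf0
  -- the reflected-pair section `𝓜̃_w`
  have h𝓜 : IsChiSectionPair (reflectChar (IsCMField.complexConj L) χ₁') χ₂' (fun x : (quasiSplit (↥(maximalRealSubfield L)) L (IsCMField.complexConj L) 3).Adelic => (∫ v : ↥(adelicUnipotent (↥(maximalRealSubfield L)) L (IsCMField.complexConj L) 3), flatSectionU φ' w ((quasiSplit (↥(maximalRealSubfield L)) L (IsCMField.complexConj L) 3).toAdelic (weylLongU ((IsCMField.complexConj L : L ≃ₐ[↥(maximalRealSubfield L)] L) : L →+* L) (rfl : (StdForm.antidiagonal 3).over L = (StdForm.antidiagonal 3).over L)) * ((v : (quasiSplit (↥(maximalRealSubfield L)) L (IsCMField.complexConj L) 3).Adelic) * x)) ∂ν) * (((borelHeight x : ℝ) : ℂ) ^ (w - 2))) :=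
    isChiSectionPair_intertwinedCoeff_three hc hc1 ν hφ' hφ'c.measurable w
  have h𝓜c : Continuous (fun x : (quasiSplit (↥(maximalRealSubfield L)) L (IsCMField.complexConj L) 3).Adelic => (∫ v : ↥(adelicUnipotent (↥(maximalRealSubfield L)) L (IsCMField.complexConj L) 3), flatSectionU φ' w ((quasiSplit (↥(maximalRealSubfield L)) L (IsCMField.complexConj L) 3).toAdelic (weylLongU ((IsCMField.complexConj L : L ≃ₐ[↥(maximalRealSubfield L)] L) : L →+* L) (rfl : (StdForm.antidiagonal 3).over L = (StdForm.antidiagonal 3).over L)) * ((v : (quasiSplit (↥(maximalRealSubfield L)) L (IsCMField.complexConj L) 3).Adelic) * x)) ∂ν) * (((borelHeight x : ℝ) : ℂ) ^ (w - 2))) := continuous_intertwinedCoeff L ν h𝓕N h𝓕c hχ₂' hφ' hφ'c hφ'C hw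
  obtain ⟨C𝓜, hC𝓜⟩ := exists_norm_intertwinedCoeff_le L ν h𝓕N h𝓕c hφ'C hw
  have hχ₁'wu : (reflectChar (IsCMField.complexConj L) χ₁').IsUnitary := fun a => norm_reflectChar_apply_of_isUnitary hχ₁'u a
  -- ★ C4a with second pair `(χ₁′ʷ, χ₂′)`, second section `𝓜̃_w`, second profile `f′_w = r^{2−w}·b`
  obtain ⟨hI, hE⟩ := integral_weight_smul_wOne_eq_zero_cm_three L νG μK νI h𝓕I hβ hχ₁'wu hχ₂ hχ₂' hna hφ hφc hφC h𝓜 h𝓜c hC𝓜 hf hfs hf0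
    (continuous_sliceProfile hbc hb0 w) (hasCompactSupport_sliceProfile hbs w)
  have hpt : ∀ g : (quasiSplit (↥(maximalRealSubfield L)) L (IsCMField.complexConj L) 3).Adelic, (β g).toReal • (f (borelHeight g : ℝ) * φ g * conj (∫ v : ↥(adelicUnipotent (↥(maximalRealSubfield L)) L (IsCMField.complexConj L) 3), flatSectionU φ' w ((quasiSplit (↥(maximalRealSubfield L)) L (IsCMField.complexConj L) 3).toAdelic (weylLongU ((IsCMField.complexConj L : L ≃ₐ[↥(maximalRealSubfield L)] L) : L →+* L) (rfl : (StdForm.antidiagonal 3).over L = (StdForm.antidiagonal 3).over L)) * (v : (quasiSplit (↥(maximalRealSubfield L)) L (IsCMField.complexConj L) 3).Adelic) * g) ∂ν)) =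
      (β g).toReal • (f (borelHeight g : ℝ) * φ g * conj ((fun r : ℝ => (r : ℂ) ^ (2 - w) * ((b r : ℝ) : ℂ)) (borelHeight g : ℝ) * (fun x : (quasiSplit (↥(maximalRealSubfield L)) L (IsCMField.complexConj L) 3).Adelic => (∫ v : ↥(adelicUnipotent (↥(maximalRealSubfield L)) L (IsCMField.complexConj L) 3), flatSectionU φ' w ((quasiSplit (↥(maximalRealSubfield L)) L (IsCMField.complexConj L) 3).toAdelic (weylLongU ((IsCMField.complexConj L : L ≃ₐ[↥(maximalRealSubfield L)] L) : L →+* L) (rfl : (StdForm.antidiagonal 3).over L = (StdForm.antidiagonal 3).over L)) * ((v : (quasiSplit (↥(maximalRealSubfield L)) L (IsCMField.complexConj L) 3).Adelic) * x)) ∂ν) * (((borelHeight x : ℝ) : ℂ) ^ (w - 2))) g)) := fun g => by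
    simp only [slice_integrand_eq L ν hb1 w g]
  simp_rw [hpt]
  exact ⟨hI, hE⟩

/-! ## §4 HEAD `HITS`: the slice in Mellin currency when the reflected pair is `(χ₁, χ₂)` itself -/

/-- **hFub-c2∕c3 `HITS` — THE `w`-SLICE OF THE INTERTWINED BRACKET ON THE STRICT SELF-DUAL LOCUS.**  Structural data as in §3.  There are `K ∈ (0,∞)` (★ (δ)₃'s constant) and
`V = idelicCovolume L ν_I` such that for every covering weight `β`, every UNITARY `χ₁`, AUTOMORPHIC `χ₂`, Hecke character `χ₁′` with `reflectChar c χ₁′ = χ₁` (the reflected pair IS `(χ₁,χ₂)`),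
continuous bounded pair sections `φ ∈ (χ₁,χ₂)`, `φ′ ∈ (χ₁′,χ₂)`, `f ∈ C_c((0,∞))` and `Re w > 2`: the slice integrand is in `L¹(ν_G)` and
**`S_w = ∫ β•((f∘H)φ·conj(∫_N f′^{φ′}_w(w₀vg)dν)) dν_G = K·V·mellin f(−w̄)·⟪φ, 𝓜̃_w⟫_{K_U}`**, `⟪φ,𝓜̃_w⟫_{K_U} = ∫_{K_U} φ·conj 𝓜̃_w dμ_K` — §2 + ★ PB-1b-i p865195 (same-pair bracket in
idele-class currency, second section `𝓜̃_w`, second profile `f′_w`), `conj f′_w(‖x‖) = ‖x‖^{2−w̄}` on the support of `f(‖x‖)`, Tate's `d^×x` ★ PB-1b-ii §2, and `∫_0^∞ r^{2−w̄}f(r)r^{−3}dr = mellin f(−w̄)`.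
[cite: MoeglinWaldspurger1995, II.1.7, II.2.1] [cite: Rogawski1990, §7.3 (pp. 96–98)] [cite: TateThesis1967, §4.3] -/
theorem exists_integral_weight_smul_intertwinedSlice_eq_mellin_cm_three
    (νG : Measure (quasiSplit (↥(maximalRealSubfield L)) L (IsCMField.complexConj L) 3).Adelic) [νG.IsHaarMeasure] (μK : Measure ((standardMaximalCompactGL 3 L).comap (adelicVal (↥(maximalRealSubfield L)) L (IsCMField.complexConj L) 3 ((StdForm.antidiagonal 3).over L)) : Subgroup (quasiSplit (↥(maximalRealSubfield L)) L (IsCMField.complexConj L) 3).Adelic)) [μK.IsHaarMeasure] (νI : Measure (AdeleRing (𝓞 L) L)ˣ) [νI.IsHaarMeasure]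
    {𝓕I : Set (AdeleRing (𝓞 L) L)ˣ} (h𝓕I : IsIdeleClassDomain L 𝓕I)
    (ν : Measure ↥(adelicUnipotent (↥(maximalRealSubfield L)) L (IsCMField.complexConj L) 3)) [ν.IsHaarMeasure] {𝓕 : Set ↥(adelicUnipotent (↥(maximalRealSubfield L)) L (IsCMField.complexConj L) 3)}
    (h𝓕N : IsFundamentalDomain ↥(rationalUnipotent (↥(maximalRealSubfield L)) L (IsCMField.complexConj L) 3) 𝓕 ν) (h𝓕c : IsCompact (closure 𝓕)) :
    ∃ K : ℝ≥0∞, K ≠ 0 ∧ K ≠ ∞ ∧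
      ∀ {β : (quasiSplit (↥(maximalRealSubfield L)) L (IsCMField.complexConj L) 3).Adelic → ℝ≥0∞}, IsCoveringWeight ((arithmeticBorel (↥(maximalRealSubfield L)) L (IsCMField.complexConj L) 3).map (quasiSplit (↥(maximalRealSubfield L)) L (IsCMField.complexConj L) 3).arithmeticSubgroup.subtype) β →
      ∀ {χ₁ χ₁' : HeckeCharacter L} {χ₂ : ↥(TorusDict.torus (IsCMField.complexConj L)) →ₜ* ℂˣ} {φ φ' : (quasiSplit (↥(maximalRealSubfield L)) L (IsCMField.complexConj L) 3).Adelic → ℂ},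
        χ₁.IsUnitary → TorusDict.IsAutomorphic (IsCMField.complexConj L) χ₂ → reflectChar (IsCMField.complexConj L) χ₁' = χ₁ →
        IsChiSectionPair χ₁ χ₂ φ → Continuous φ → ∀ {Cφ : ℝ}, (∀ x, ‖φ x‖ ≤ Cφ) →
        IsChiSectionPair χ₁' χ₂ φ' → Continuous φ' → ∀ {Cφ' : ℝ}, (∀ x, ‖φ' x‖ ≤ Cφ') →
      ∀ {f : ℝ → ℂ}, Continuous f → HasCompactSupport f → tsupport f ⊆ Ioi 0 → ∀ {w : ℂ}, 2 < w.re →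
        Integrable (fun g : (quasiSplit (↥(maximalRealSubfield L)) L (IsCMField.complexConj L) 3).Adelic => (β g).toReal • (f (borelHeight g : ℝ) * φ g * conj (∫ v : ↥(adelicUnipotent (↥(maximalRealSubfield L)) L (IsCMField.complexConj L) 3), flatSectionU φ' w ((quasiSplit (↥(maximalRealSubfield L)) L (IsCMField.complexConj L) 3).toAdelic (weylLongU ((IsCMField.complexConj L : L ≃ₐ[↥(maximalRealSubfield L)] L) : L →+* L) (rfl : (StdForm.antidiagonal 3).over L = (StdForm.antidiagonal 3).over L)) * (v : (quasiSplit (↥(maximalRealSubfield L)) L (IsCMField.complexConj L) 3).Adelic) * g) ∂ν))) νG ∧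
        ∫ g : (quasiSplit (↥(maximalRealSubfield L)) L (IsCMField.complexConj L) 3).Adelic, (β g).toReal • (f (borelHeight g : ℝ) * φ g * conj (∫ v : ↥(adelicUnipotent (↥(maximalRealSubfield L)) L (IsCMField.complexConj L) 3), flatSectionU φ' w ((quasiSplit (↥(maximalRealSubfield L)) L (IsCMField.complexConj L) 3).toAdelic (weylLongU ((IsCMField.complexConj L : L ≃ₐ[↥(maximalRealSubfield L)] L) : L →+* L) (rfl : (StdForm.antidiagonal 3).over L = (StdForm.antidiagonal 3).over L)) * (v : (quasiSplit (↥(maximalRealSubfield L)) L (IsCMField.complexConj L) 3).Adelic) * g) ∂ν)) ∂νG =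
          (K.toReal : ℂ) * ((idelicCovolume L νI).toReal : ℂ) * (mellin f (-conj w) * ∫ k : ((standardMaximalCompactGL 3 L).comap (adelicVal (↥(maximalRealSubfield L)) L (IsCMField.complexConj L) 3 ((StdForm.antidiagonal 3).over L)) : Subgroup (quasiSplit (↥(maximalRealSubfield L)) L (IsCMField.complexConj L) 3).Adelic), φ (k : (quasiSplit (↥(maximalRealSubfield L)) L (IsCMField.complexConj L) 3).Adelic) * conj ((∫ v : ↥(adelicUnipotent (↥(maximalRealSubfield L)) L (IsCMField.complexConj L) 3), flatSectionU φ' w ((quasiSplit (↥(maximalRealSubfield L)) L (IsCMField.complexConj L) 3).toAdelic (weylLongU ((IsCMField.complexConj L : L ≃ₐ[↥(maximalRealSubfield L)] L) : L →+* L) (rfl : (StdForm.antidiagonal 3).over L = (StdForm.antidiagonal 3).over L)) * ((v : (quasiSplit (↥(maximalRealSubfield L)) L (IsCMField.complexConj L) 3).Adelic) * (k : (quasiSplit (↥(maximalRealSubfield L)) L (IsCMField.complexConj L) 3).Adelic))) ∂ν) * (((borelHeight (k : (quasiSplit (↥(maximalRealSubfield L)) L (IsCMField.complexConj L) 3).Adelic)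 : ℝ) : ℂ) ^ (w - 2))) ∂μK) := by
  haveI := t2Space_adeleRing_of_numberField L
  haveI := locallyCompactSpace_adeleRing' L
  have hc : IsCMField.complexConj L * IsCMField.complexConj L = 1 := AlgEquiv.ext fun x => IsCMField.complexConj_apply_apply L x
  have hc1 : IsCMField.complexConj L ≠ 1 := IsCMField.complexConj_ne_one L
  obtain ⟨K, hK0, hKt, hH⟩ := integral_weight_smul_wOne_eq_setIntegral_ideleClass_cm_three L νG μK νI h𝓕I
  refine ⟨K, hK0, hKt, ?_⟩
  intro β hβ χ₁ χ₁' χ₂ φ φ' hχ₁u hχ₂ hw₀ hφ hφc Cφ hφC hφ' hφ'c Cφ' hφ'C f hf hfs hf0 w hw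
  obtain ⟨b, hbc, hbs, hb0, hb1⟩ := exists_bump_eq_one_on_tsupport hfs hf0
  -- the reflected-pair section `𝓜̃_w` is a `(χ₁, χ₂)`-section here
  have h𝓜 : IsChiSectionPair χ₁ χ₂ (fun x : (quasiSplit (↥(maximalRealSubfield L)) L (IsCMField.complexConj L) 3).Adelic => (∫ v : ↥(adelicUnipotent (↥(maximalRealSubfield L)) L (IsCMField.complexConj L) 3), flatSectionU φ' w ((quasiSplit (↥(maximalRealSubfield L)) L (IsCMField.complexConj L) 3).toAdelic (weylLongU ((IsCMField.complexConj L : L ≃ₐ[↥(maximalRealSubfield L)] L) : L →+* L) (rfl : (StdForm.antidiagonal 3).over L = (StdForm.antidiagonal 3).over L)) * ((v : (quasiSplit (↥(maximalRealSubfield L)) L (IsCMField.complexConj L) 3).Adelic) * x)) ∂ν) * (((borelHeight x : ℝ) : ℂ) ^ (w - 2))) :=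
    hw₀ ▸ isChiSectionPair_intertwinedCoeff_three hc hc1 ν hφ' hφ'c.measurable w
  have h𝓜c : Continuous (fun x : (quasiSplit (↥(maximalRealSubfield L)) L (IsCMField.complexConj L) 3).Adelic => (∫ v : ↥(adelicUnipotent (↥(maximalRealSubfield L)) L (IsCMField.complexConj L) 3), flatSectionU φ' w ((quasiSplit (↥(maximalRealSubfield L)) L (IsCMField.complexConj L) 3).toAdelic (weylLongU ((IsCMField.complexConj L : L ≃ₐ[↥(maximalRealSubfield L)] L) : L →+* L) (rfl : (StdForm.antidiagonal 3).over L = (StdForm.antidiagonal 3).over L)) * ((v : (quasiSplit (↥(maximalRealSubfield L)) L (IsCMField.complexConj L) 3).Adelic) * x)) ∂ν) * (((borelHeight x : ℝ) : ℂ) ^ (w - 2))) := continuous_intertwinedCoeff L ν h𝓕N h𝓕c hχ₂ hφ' hφ'c hφ'C hw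
  obtain ⟨C𝓜, hC𝓜⟩ := exists_norm_intertwinedCoeff_le L ν h𝓕N h𝓕c hφ'C hw
  -- ★ PB-1b-i with second section `𝓜̃_w`, second profile `f′_w`
  obtain ⟨hI, -, hE⟩ := hH hβ hχ₁u hχ₂ hφ hφc hφC h𝓜 h𝓜c hC𝓜 hf hfs hf0 (continuous_sliceProfile hbc hb0 w) (hasCompactSupport_sliceProfile hbs w)
  have hpt : ∀ g : (quasiSplit (↥(maximalRealSubfield L)) L (IsCMField.complexConj L) 3).Adelic, (β g).toReal • (f (borelHeight g : ℝ) * φ g * conj (∫ v : ↥(adelicUnipotent (↥(maximalRealSubfield L)) L (IsCMField.complexConj L) 3), flatSectionU φ' w ((quasiSplit (↥(maximalRealSubfield L)) L (IsCMField.complexConj L) 3).toAdelic (weylLongU ((IsCMField.complexConj L : L ≃ₐ[↥(maximalRealSubfield L)] L) : L →+* L) (rfl : (StdForm.antidiagonal 3).over L = (StdForm.antidiagonal 3).over L)) * (v : (quasiSplit (↥(maximalRealSubfield L)) L (IsCMField.complexConj L) 3).Adelic) * g) ∂ν)) =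
      (β g).toReal • (f (borelHeight g : ℝ) * φ g * conj ((fun r : ℝ => (r : ℂ) ^ (2 - w) * ((b r : ℝ) : ℂ)) (borelHeight g : ℝ) * (fun x : (quasiSplit (↥(maximalRealSubfield L)) L (IsCMField.complexConj L) 3).Adelic => (∫ v : ↥(adelicUnipotent (↥(maximalRealSubfield L)) L (IsCMField.complexConj L) 3), flatSectionU φ' w ((quasiSplit (↥(maximalRealSubfield L)) L (IsCMField.complexConj L) 3).toAdelic (weylLongU ((IsCMField.complexConj L : L ≃ₐ[↥(maximalRealSubfield L)] L) : L →+* L) (rfl : (StdForm.antidiagonal 3).over L = (StdForm.antidiagonal 3).over L)) * ((v : (quasiSplit (↥(maximalRealSubfield L)) L (IsCMField.complexConj L) 3).Adelic) * x)) ∂ν) * (((borelHeight x : ℝ) : ℂ) ^ (w - 2))) g)) := fun g => by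
    simp only [slice_integrand_eq L ν hb1 w g]
  simp_rw [hpt]
  refine ⟨hI, ?_⟩
  rw [hE]
  -- the idele-class integrand: `f(‖x‖)·conj f′_w(‖x‖) = ‖x‖^{2−w̄}·f(‖x‖)` (bump ≡ 1 on the support of `f`)
  have hrad : ∀ x : (AdeleRing (𝓞 L) L)ˣ,
      f (IdeleClassGroup.ideleNorm L x : ℝ) * conj ((fun r : ℝ => (r : ℂ) ^ (2 - w) * ((b r : ℝ) : ℂ)) (IdeleClassGroup.ideleNorm L x : ℝ)) * (∫ k : ((standardMaximalCompactGL 3 L).comap (adelicVal (↥(maximalRealSubfield L)) L (IsCMField.complexConj L) 3 ((StdForm.antidiagonal 3).over L)) : Subgroup (quasiSplit (↥(maximalRealSubfield L)) L (IsCMField.complexConj L) 3).Adelic), φ (k : (quasiSplit (↥(maximalRealSubfield L)) L (IsCMField.complexConj L) 3).Adelic) * conj ((∫ v : ↥(adelicUnipotent (↥(maximalRealSubfield L)) L (IsCMField.complexConj L) 3), flatSectionU φ' w ((quasiSplit (↥(maximalRealSubfield L)) L (IsCMField.complexConj L) 3).toAdelic (weylLongU ((IsCMField.complexConj L : L ≃ₐ[↥(maximalRealSubfield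 L)] L) : L →+* L) (rfl : (StdForm.antidiagonal 3).over L = (StdForm.antidiagonal 3).over L)) * ((v : (quasiSplit (↥(maximalRealSubfield L)) L (IsCMField.complexConj L) 3).Adelic) * (k : (quasiSplit (↥(maximalRealSubfield L)) L (IsCMField.complexConj L) 3).Adelic))) ∂ν) * (((borelHeight (k : (quasiSplit (↥(maximalRealSubfield L)) L (IsCMField.complexConj L) 3).Adelic) : ℝ) : ℂ) ^ (w - 2))) ∂μK) =
        (fun r : ℝ => (r : ℂ) ^ (2 - conj w) * f r * (∫ k : ((standardMaximalCompactGL 3 L).comap (adelicVal (↥(maximalRealSubfield L)) L (IsCMField.complexConj L) 3 ((StdForm.antidiagonal 3).over L)) : Subgroup (quasiSplit (↥(maximalRealSubfield L)) L (IsCMField.complexConj L) 3).Adelic), φ (k : (quasiSplit (↥(maximalRealSubfield L)) L (IsCMField.complexConj L) 3).Adelic) * conj ((∫ v : ↥(adelicUnipotent (↥(maximalRealSubfield L)) L (IsCMField.complexConj L) 3), flatSectionU φ' w ((quasiSplit (↥(maximalRealSubfield L)) L (IsCMField.complexConj L) 3).toAdelic (weylLongU ((IsCMField.complexConj L : L ≃ₐ[↥(maximalRealSubfield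 L)] L) : L →+* L) (rfl : (StdForm.antidiagonal 3).over L = (StdForm.antidiagonal 3).over L)) * ((v : (quasiSplit (↥(maximalRealSubfield L)) L (IsCMField.complexConj L) 3).Adelic) * (k : (quasiSplit (↥(maximalRealSubfield L)) L (IsCMField.complexConj L) 3).Adelic))) ∂ν) * (((borelHeight (k : (quasiSplit (↥(maximalRealSubfield L)) L (IsCMField.complexConj L) 3).Adelic) : ℝ) : ℂ) ^ (w - 2))) ∂μK)) (IdeleClassGroup.ideleNorm L x : ℝ) := fun x => by
    by_cases hfx : f (IdeleClassGroup.ideleNorm L x : ℝ) = 0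
    · simp only [hfx, zero_mul, mul_zero]
    · have hb : b (IdeleClassGroup.ideleNorm L x : ℝ) = 1 := hb1 _ (subset_tsupport f hfx)
      have hpos : 0 < (IdeleClassGroup.ideleNorm L x : ℝ) := hf0 (subset_tsupport f hfx)
      simp only [hb, Complex.ofReal_one, map_mul, mul_one, conj_ofReal_cpow_two_sub hpos w]
      ring
  simp_rw [hrad]
  rw [setIntegral_mul_inv_ideleNorm_smul_comp_eq νI h𝓕I (φ := fun r : ℝ => (r : ℂ) ^ (2 - conj w) * f r * (∫ k : ((standardMaximalCompactGL 3 L).comap (adelicVal (↥(maximalRealSubfield L)) L (IsCMField.complexConj L) 3 ((StdForm.antidiagonal 3).over L)) : Subgroup (quasiSplit (↥(maximalRealSubfield L)) L (IsCMField.complexConj L) 3).Adelic), φ (k : (quasiSplit (↥(maximalRealSubfield L)) L (IsCMField.complexConj L) 3).Adelic) * conj ((∫ v : ↥(adelicUnipotent (↥(maximalRealSubfield L)) L (IsCMField.complexConj L) 3), flatSectionU φ' w ((quasiSplit (↥(maximalRealSubfield L)) L (IsCMField.complexConj L) 3).toAdelic (weylLongU ((IsCMField.complexConj L : L ≃ₐ[↥(maximalRealSubfield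 L)] L) : L →+* L) (rfl : (StdForm.antidiagonal 3).over L = (StdForm.antidiagonal 3).over L)) * ((v : (quasiSplit (↥(maximalRealSubfield L)) L (IsCMField.complexConj L) 3).Adelic) * (k : (quasiSplit (↥(maximalRealSubfield L)) L (IsCMField.complexConj L) 3).Adelic))) ∂ν) * (((borelHeight (k : (quasiSplit (↥(maximalRealSubfield L)) L (IsCMField.complexConj L) 3).Adelic) : ℝ) : ℂ) ^ (w - 2))) ∂μK))
      ((((continuous_ofReal_cpow_mul hf hf0 (2 - conj w)).mul continuous_const).comp Real.continuous_exp).aestronglyMeasurable),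
    Complex.real_smul, setIntegral_sliceRadial_mul_cpow_neg_three]
  ring

end Heads

end Summit.HodgeConjecture.HodgeConjecture.Cruxes.H413.K2E1ChiIntertwinedSliceBracketCMThree

end
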